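import Summits.QuantumFields.YangMills.Theorems.WeakCouplingRates
import HarnessLib

/-!
# `JensenFloor` (stmt-QuantumFields-22518), line `birth`: Jensen on the torus (registered stub `stub_jensen`)

Support file for the crux item stmt-QuantumFields-22518 (`Summit.QuantumFields.YangMills.Theses.SourcedPressureJensen.JensenFloor`,
route `SourcedPressureJensen`, a RECORD-label rung line: its target `WeakCouplingRates.XiPow` is an UPPER bound on the lattice gap,
NOT the Clay mass gap).  Registered stub `stub_jensen` of the line `birth`: for the torus Wilson state `μ = μ_{Λ_{L+1}, β}` of the
compact simple gauge group `G` in the lattice representation `r` and the centred two-plaquette source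
`H = Σ_x (β c(x) − β⟨c⟩)(β c(x + n e₀) − β⟨c⟩)` (`c` the `(1,2)`-plaquette cost read through the periodic lift),
`−h · E_μ[H] ≤ log E_μ[exp(−h H)]`.

**Proof.** `μ` is a probability measure (`isProbabilityMeasure_wilsonMeasure`, `r.ρ` continuous); `H` is continuous on the compact
configuration space `G^{edges}` (continuity of `plaqCost0`, of the translations `configShift`, `timeShiftLG` and of the periodic lift
`torusLift`), hence bounded and integrable, and so is `exp(−hH)`; Jensen's inequality for the convex `exp`
(`ConvexOn.map_integral_le`) gives `exp(E[−hH]) ≤ E[exp(−hH)]`, and `log` is monotone.  Measurability uses that `G` is second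
countable (it embeds into `M_N(ℂ)` by the faithful representation `r`). [folklore]
-/

namespace Summit.QuantumFields.YangMills.Cruxes.JensenFloor.Birth

open MeasureTheory
open Literature.MathematicalPhysics.QuantumFieldTheory Literature.MathematicalPhysics.QuantumLattice
  Summit.QuantumFields.YangMills.Theorems.WeakCouplingRates

/-- **Jensen for exponential moments.** On a probability space, for a bounded a.e.-strongly-measurable real `H` and every real
`h`, `−h · E[H] ≤ log E[exp(−h H)]`. [folklore] -/
theorem neg_mul_integral_le_log_integral_exp {Ω : Type*} [MeasurableSpace Ω] {μ : Measure Ω} [IsProbabilityMeasure μ]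
    {H : Ω → ℝ} (hHm : AEStronglyMeasurable H μ) {C : ℝ} (hC : ∀ ω, |H ω| ≤ C) (h : ℝ) :
    -h * ∫ ω, H ω ∂μ ≤ Real.log (∫ ω, Real.exp (-h * H ω) ∂μ) := by
  have hH : Integrable H μ :=
    Integrable.of_bound hHm C (ae_of_all _ fun ω => by simpa [Real.norm_eq_abs] using hC ω)
  have hf : Integrable (fun ω => -h * H ω) μ := hH.const_mul _
  have hexp : Integrable (fun ω => Real.exp (-h * H ω)) μ := by
    refine Integrable.of_bound (Real.continuous_exp.comp_aestronglyMeasurable hf.aestronglyMeasurable)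
      (Real.exp (|h| * C)) (ae_of_all _ fun ω => ?_)
    rw [Real.norm_eq_abs, abs_of_pos (Real.exp_pos _), Real.exp_le_exp]
    calc -h * H ω ≤ |-h * H ω| := le_abs_self _
      _ = |h| * |H ω| := by rw [abs_mul, abs_neg]
      _ ≤ |h| * C := mul_le_mul_of_nonneg_left (hC ω) (abs_nonneg _)
  have hJ := ConvexOn.map_integral_le (μ := μ) (f := fun ω => -h * H ω) (g := Real.exp) convexOn_exp
    Real.continuous_exp.continuousOn isClosed_univ (ae_of_all _ fun _ => Set.mem_univ _) hf hexp
  rw [integral_const_mul] at hJ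
  calc -h * ∫ ω, H ω ∂μ = Real.log (Real.exp (-h * ∫ ω, H ω ∂μ)) := (Real.log_exp _).symm
    _ ≤ Real.log (∫ ω, Real.exp (-h * H ω) ∂μ) := Real.log_le_log (Real.exp_pos _) hJ

/-- A continuous real function on a compact space is bounded in absolute value. [folklore] -/
theorem exists_abs_le_of_continuous {X : Type*} [TopologicalSpace X] [CompactSpace X] {F : X → ℝ}
    (hF : Continuous F) : ∃ C : ℝ, ∀ x, |F x| ≤ C := by
  obtain ⟨C, hC⟩ := (isCompact_univ (X := X)).exists_bound_of_continuousOn hF.continuousOn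
  exact ⟨C, fun x => by simpa [Real.norm_eq_abs] using hC x (Set.mem_univ x)⟩

/-- `stub_jensen` — **Jensen on the torus** (registered stub of the line `birth` for the crux `JensenFloor`): for the torus
Wilson state at `(r.ρ, β, Λ_{L+1})` (a probability measure) and the bounded continuous centred two-plaquette source
`H_{n,Λ} = Σ_x (β c(x) − β⟨c⟩)(β c(x + n e₀) − β⟨c⟩)`, `−h · E[H] ≤ log E[exp(−h H)]` — convexity of `exp` (Jensen) and
monotonicity of `log`. [folklore] -/
theorem stub_jensen :
    ∀ (G : Type) [Group G] [TopologicalSpace G] [IsTopologicalGroup G] [CompactSpace G]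
      [MeasurableSpace G] [BorelSpace G] (r : LatticeRep G) (β : ℝ) (n : ℕ) (h : ℝ) (L : ℕ),
      -h *
          wilsonExpectation r.ρ β (fun U : GaugeConfig 4 (L + 1) G =>
            ∑ x : Fin 4 → Fin (L + 1),
              toTorusObservable (L + 1)
                (fun V : LGConfig 4 G =>
                  (β * plaqCost0 r.ρ 1 2 (configShift (fun i => -((x i : ℕ) : ℤ)) V) -
                      β * wilsonExpectation r.ρ β (toTorusObservable (L + 1) (plaqCost0 r.ρ 1 2 : LGConfig 4 G → ℝ))) *
                    (β * plaqCost0 r.ρ 1 2 (timeShiftLG n (configShift (fun i => -((x i : ℕ) : ℤ)) V)) -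
                      β * wilsonExpectation r.ρ β (toTorusObservable (L + 1) (plaqCost0 r.ρ 1 2 : LGConfig 4 G → ℝ))))
                U) ≤
        Real.log
          (wilsonExpectation r.ρ β fun U : GaugeConfig 4 (L + 1) G =>
            Real.exp
              (-h *
                ∑ x : Fin 4 → Fin (L + 1),
                  toTorusObservable (L + 1)
                    (fun V : LGConfig 4 G =>
                      (β * plaqCost0 r.ρ 1 2 (configShift (fun i => -((x i : ℕ) : ℤ)) V) -
                          β * wilsonExpectation r.ρ β (toTorusObservable (L + 1) (plaqCost0 r.ρ 1 2 : LGConfig 4 G → ℝ))) *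
                        (β * plaqCost0 r.ρ 1 2 (timeShiftLG n (configShift (fun i => -((x i : ℕ) : ℤ)) V)) -
                          β * wilsonExpectation r.ρ β (toTorusObservable (L + 1) (plaqCost0 r.ρ 1 2 : LGConfig 4 G → ℝ))))
                    U)) := by
  intro G _ _ _ _ _ _ r β n h L
  haveI : SecondCountableTopology G :=
    (r.continuous.isClosedEmbedding r.injective).isEmbedding.secondCountableTopology
  haveI := isProbabilityMeasure_wilsonMeasure (d := 4) (L := L + 1) r.ρ r.continuous β
  -- the plaquette cost is continuous; so are the translations and the periodic lift
  have hc : Continuous (plaqCost0 (d := 4) (G := G) r.ρ 1 2) := (continuous_bounded_plaqCost0 r.ρ r.continuous 1 2).1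
  set m : ℝ := wilsonExpectation r.ρ β (toTorusObservable (L + 1) (plaqCost0 r.ρ 1 2 : LGConfig 4 G → ℝ)) with hm
  set H : GaugeConfig 4 (L + 1) G → ℝ := fun U =>
    ∑ x : Fin 4 → Fin (L + 1),
      toTorusObservable (L + 1)
        (fun V =>
          (β * plaqCost0 (d := 4) r.ρ 1 2 (configShift (fun i => -((x i : ℕ) : ℤ)) V) - β * m) *
            (β * plaqCost0 (d := 4) r.ρ 1 2 (timeShiftLG (G := G) n (configShift (fun i => -((x i : ℕ) : ℤ)) V)) - β * m))
        U with hH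
  have hHc : Continuous H := by
    refine continuous_finsetSum _ fun x _ => ?_
    have hs : Continuous (configShift (G := G) (fun i => -((x i : ℕ) : ℤ)) : LGConfig 4 G → LGConfig 4 G) :=
      continuous_configShift _
    have ht : Continuous (timeShiftLG (d := 4) (G := G) n : LGConfig 4 G → LGConfig 4 G) := continuous_timeShiftLG n
    have hg : Continuous fun V : LGConfig 4 G =>
        (β * plaqCost0 (d := 4) r.ρ 1 2 (configShift (fun i => -((x i : ℕ) : ℤ)) V) - β * m) *
          (β * plaqCost0 (d := 4) r.ρ 1 2 (timeShiftLG (G := G) n (configShift (fun i => -((x i : ℕ) : ℤ)) V)) - β * m) :=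
      ((continuous_const.mul (hc.comp hs)).sub continuous_const).mul
        ((continuous_const.mul (hc.comp (ht.comp hs))).sub continuous_const)
    exact hg.comp (continuous_torusLift (L + 1))
  obtain ⟨C, hC⟩ := exists_abs_le_of_continuous hHc
  have key := neg_mul_integral_le_log_integral_exp (μ := wilsonMeasure (d := 4) (L := L + 1) r.ρ β)
    hHc.aestronglyMeasurable hC h
  simpa only [wilsonExpectation, hH] using key

end Summit.QuantumFields.YangMills.Cruxes.JensenFloor.Birth
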